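import Summits.PneNP.PneNP.Theorems.ChebyshevTracialDesignLevelMarginals
import HarnessLib

/-!
# Cell pnp-psdrank, route `ChebyshevTracialDesign`: the stabiliser of a perfect matching is vertex-transitive, so the
# level kernels annihilate dipoles (the "odd modes vanish" input of the harmonic analysis)

For a perfect matching `M` of `K_n` and two vertices `x, y`, the permutation `(x y)(M(x) M(y))` (or `(x M(x))` when
`y = M(x)`) fixes `M` and maps `x` to `y` (`exists_perm_smul_eq_self`): the stabiliser of `M` in `𝔖ₙ` is transitive on
vertices [cite: GodsilMeagher2015, §15.2 (the perfect matching scheme; `Stab(M) = S₂ ≀ S_m`)]. Consequences for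
Rothvoß's level classes `Q_c(t)` [cite: Rothvoss2017, §2 (PDF p. 6)]:
* `card_level_through_vertex_eq`: the number of `t`-cuts `U` at crossing level `c` for `M` that contain a given vertex
  does not depend on the vertex;
* `sum_level_dipole_eq_zero`, `sum_Qset_dipole_mul_eq_zero`: every DIPOLE `U ↦ 1[x ∈ U] − 1[y ∈ U]` (the generators
  of the first harmonic component of the Johnson scheme) sums to zero over `{U : |U| = t, cc(U,M) = c}` for every `M`,
  hence is orthogonal, through every level class, to every function of the matching: the bi-kernels `K_c` between
  `t`-sets and perfect matchings kill the `(n−1,1)`-isotypic component — planner p1's "only even modes `k`" in the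
  profile expansion `Φ(c) = Φ̄ + Σ_{k ≥ 2} σ_k(c) β_k` (HOME/pnp-psdrank-p1/N2-SpreadStructure.md §SNT), in elementary
  form and kernel-checked.
WHAT THIS IS NOT: nothing about modes `k ≥ 2` (the quantitative content, σ₂ ≍ n^{−1/2}, is not formalised); nothing on
psd rank. Supports crux stmt-PneNP-19878.
-/

set_option linter.dupNamespace false -- `Summit.PneNP.PneNP.…`: summit = sub-problem (D-0017)

noncomputable section

namespace Summit.PneNP.PneNP.Theorems.ChebyshevTracialDesignVertexTransitive

open Finset Literature.Barriers.PneNP Literature.Combinatorics.Optimization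
open Summit.PneNP.PneNP.Theorems.ChebyshevTracialDesignLevelMarginals

variable {n : ℕ}

/-! ### §1 The stabiliser of a perfect matching is vertex-transitive -/

/-- Equivariance of partners: the partner of `π v` in `π • M` is `π (partner of v in M)`. -/
theorem partner_smul (π : Equiv.Perm (Fin n)) (M : PMatch n) (v : Fin n) :
    PMSol.partner (π • M) (π v) = π (PMSol.partner M v) := by
  symm
  rw [← PMSol.mk_mem_iff, PMSol.smul_val]
  have : s(π v, π (PMSol.partner M v)) = Sym2.map π s(v, PMSol.partner M v) := by rw [Sym2.map_mk]
  rw [this]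
  exact mem_image_of_mem _ (PMSol.mk_partner_mem M v)

/-- A permutation commuting with the partner involution of `M` fixes `M`. -/
theorem smul_eq_self_of_comm (π : Equiv.Perm (Fin n)) (M : PMatch n)
    (h : ∀ v, π (PMSol.partner M v) = PMSol.partner M (π v)) : π • M = M := by
  refine PMSol.ext_of_partner fun w => ?_
  have := partner_smul π M (π.symm w)
  rw [Equiv.apply_symm_apply] at this
  rw [this, h, Equiv.apply_symm_apply]

/-- **Vertex-transitivity of the stabiliser**: for every perfect matching `M` and vertices `x, y` there is a
permutation fixing `M` and sending `x` to `y`. -/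
theorem exists_perm_smul_eq_self (M : PMatch n) (x y : Fin n) :
    ∃ π : Equiv.Perm (Fin n), π • M = M ∧ π x = y := by
  classical
  set p : Fin n → Fin n := PMSol.partner M with hp
  have hpp : ∀ v, p (p v) = v := fun v => PMSol.partner_partner M v
  have hpne : ∀ v, p v ≠ v := fun v => PMSol.partner_ne M v
  have hpinj : ∀ v w, p v = p w → v = w := fun v w h => by rw [← hpp v, h, hpp w]
  by_cases hyx : y = p x
  · -- `y` is the partner of `x`: the transposition `(x y)` fixes `M`
    refine ⟨Equiv.swap x y, smul_eq_self_of_comm _ M fun v => ?_, Equiv.swap_apply_left x y⟩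
    show Equiv.swap x y (p v) = p (Equiv.swap x y v)
    by_cases hvx : v = x
    · rw [hvx, ← hyx, Equiv.swap_apply_right, Equiv.swap_apply_left, hyx, hpp]
    by_cases hvy : v = y
    · rw [hvy, hyx, hpp, Equiv.swap_apply_left, Equiv.swap_apply_right]
    · have hpvx : p v ≠ x := fun h' => hvy (by rw [hyx, ← h', hpp])
      have hpvy : p v ≠ y := fun h' => hvx (hpinj _ _ (by rw [h', hyx]))
      rw [Equiv.swap_apply_of_ne_of_ne hpvx hpvy, Equiv.swap_apply_of_ne_of_ne hvx hvy]
  · -- generic case: `(x y)(p x  p y)`; when `y = x` this is the identity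
    have hpyx : p y ≠ x := fun h' => hyx (by rw [← h', hpp])
    have hpxy : p x ≠ y := fun h' => hyx h'.symm
    refine ⟨Equiv.swap x y * Equiv.swap (p x) (p y), smul_eq_self_of_comm _ M fun v => ?_, ?_⟩
    · show (Equiv.swap x y * Equiv.swap (p x) (p y)) (p v) = p ((Equiv.swap x y * Equiv.swap (p x) (p y)) v)
      rw [Equiv.Perm.mul_apply, Equiv.Perm.mul_apply]
      by_cases hvx : v = x
      · rw [hvx, Equiv.swap_apply_left (p x) (p y), Equiv.swap_apply_of_ne_of_ne hpyx (hpne y),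
          Equiv.swap_apply_of_ne_of_ne (hpne x).symm hpyx.symm, Equiv.swap_apply_left x y]
      by_cases hvy : v = y
      · rw [hvy, Equiv.swap_apply_right (p x) (p y), Equiv.swap_apply_of_ne_of_ne (hpne x) hpxy,
          Equiv.swap_apply_of_ne_of_ne hyx (hpne y).symm, Equiv.swap_apply_right x y]
      by_cases hvpx : v = p x
      · rw [hvpx, hpp, Equiv.swap_apply_of_ne_of_ne (hpne x).symm hpyx.symm, Equiv.swap_apply_left x y,
          Equiv.swap_apply_left (p x) (p y), Equiv.swap_apply_of_ne_of_ne hpyx (hpne y), hpp]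
      by_cases hvpy : v = p y
      · rw [hvpy, hpp, Equiv.swap_apply_of_ne_of_ne hyx (hpne y).symm, Equiv.swap_apply_right x y,
          Equiv.swap_apply_right (p x) (p y), Equiv.swap_apply_of_ne_of_ne (hpne x) hpxy, hpp]
      · -- `v ∉ {x, y, p x, p y}`, hence `p v ∉ {x, y, p x, p y}`
        have h1 : p v ≠ x := fun h' => hvpx (by rw [← h', hpp])
        have h2 : p v ≠ y := fun h' => hvpy (by rw [← h', hpp])
        have h3 : p v ≠ p x := fun h' => hvx (hpinj _ _ h')
        have h4 : p v ≠ p y := fun h' => hvy (hpinj _ _ h')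
        rw [Equiv.swap_apply_of_ne_of_ne h3 h4, Equiv.swap_apply_of_ne_of_ne h1 h2,
          Equiv.swap_apply_of_ne_of_ne hvpx hvpy, Equiv.swap_apply_of_ne_of_ne hvx hvy]
    · rw [Equiv.Perm.mul_apply, Equiv.swap_apply_of_ne_of_ne (hpne x).symm hpyx.symm, Equiv.swap_apply_left]

/-! ### §2 Counting `t`-cuts at a level through a vertex; dipoles are killed -/

/-- **Every vertex lies on the same number of `t`-cuts at level `c`** of a fixed perfect matching `M`:
`#{U : |U| = t, cc(U,M) = c, x ∈ U} = #{U : |U| = t, cc(U,M) = c, y ∈ U}`. -/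
theorem card_level_through_vertex_eq (t c : ℕ) (M : PMatch n) (x y : Fin n) :
    (univ.filter fun U : OddSet n => U.1.card = t ∧ cc U M = c ∧ x ∈ U.1).card =
      (univ.filter fun U : OddSet n => U.1.card = t ∧ cc U M = c ∧ y ∈ U.1).card := by
  obtain ⟨π, hπM, hπx⟩ := exists_perm_smul_eq_self M x y
  refine card_bij' (fun U _ => (⟨U.1.image π, odd_card_image π U⟩ : OddSet n))
    (fun U _ => (⟨U.1.image ⇑π⁻¹, odd_card_image π⁻¹ U⟩ : OddSet n)) ?_ ?_ ?_ ?_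
  · intro U hU
    simp only [mem_filter, mem_univ, true_and] at hU ⊢
    refine ⟨by rw [card_image_of_injective _ (Equiv.injective _)]; exact hU.1, ?_, ?_⟩
    · have h := cc_perm π U M
      rw [hπM] at h
      rw [h]; exact hU.2.1
    · rw [← hπx]; exact mem_image_of_mem _ hU.2.2
  · intro U hU
    simp only [mem_filter, mem_univ, true_and] at hU ⊢
    refine ⟨by rw [card_image_of_injective _ (Equiv.injective _)]; exact hU.1, ?_, ?_⟩
    · have h := cc_perm π⁻¹ U M
      have hM : π⁻¹ • M = M := by
        conv_lhs => rw [← hπM]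
        rw [inv_smul_smul]
      rw [hM] at h
      rw [h]; exact hU.2.1
    · have : x = π⁻¹ y := by rw [← hπx]; simp
      rw [this]; exact mem_image_of_mem _ hU.2.2
  · intro U _
    exact image_inv_image_oddSet π U
  · intro U _
    exact image_image_inv_oddSet π U

/-- **Dipoles are killed by every level class of every matching**:
`Σ_{U : |U| = t, cc(U,M) = c} (1[x ∈ U] − 1[y ∈ U]) = 0`. -/
theorem sum_level_dipole_eq_zero (t c : ℕ) (M : PMatch n) (x y : Fin n) :
    ∑ U ∈ univ.filter (fun U : OddSet n => U.1.card = t ∧ cc U M = c),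
      ((if x ∈ U.1 then (1 : ℝ) else 0) - (if y ∈ U.1 then (1 : ℝ) else 0)) = 0 := by
  classical
  rw [sum_sub_distrib, sub_eq_zero]
  have hx : ∑ U ∈ univ.filter (fun U : OddSet n => U.1.card = t ∧ cc U M = c), (if x ∈ U.1 then (1 : ℝ) else 0) =
      ((univ.filter fun U : OddSet n => U.1.card = t ∧ cc U M = c ∧ x ∈ U.1).card : ℝ) := by
    rw [← sum_filter, filter_filter, sum_const, nsmul_eq_mul, mul_one]
    simp_rw [and_assoc]
  have hy : ∑ U ∈ univ.filter (fun U : OddSet n => U.1.card = t ∧ cc U M = c), (if y ∈ U.1 then (1 : ℝ) else 0) =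
      ((univ.filter fun U : OddSet n => U.1.card = t ∧ cc U M = c ∧ y ∈ U.1).card : ℝ) := by
    rw [← sum_filter, filter_filter, sum_const, nsmul_eq_mul, mul_one]
    simp_rw [and_assoc]
  rw [hx, hy, card_level_through_vertex_eq t c M x y]

/-- **The level kernels annihilate the first harmonic component**: for every function `g` of the matching, every cut
size `t`, every level `c` and every dipole, `Σ_{(U,M) ∈ Q_c(t)} (1[x ∈ U] − 1[y ∈ U])·g(M) = 0` — the `t`-set mode 1
has no partner on the matching side ("only even modes" in the profile expansion). -/
theorem sum_Qset_dipole_mul_eq_zero (t c : ℕ) (x y : Fin n) (g : PMatch n → ℝ) :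
    ∑ q ∈ Qset n t c, ((if x ∈ q.1.1 then (1 : ℝ) else 0) - (if y ∈ q.1.1 then (1 : ℝ) else 0)) * g q.2 = 0 := by
  classical
  calc ∑ q ∈ Qset n t c, ((if x ∈ q.1.1 then (1 : ℝ) else 0) - (if y ∈ q.1.1 then (1 : ℝ) else 0)) * g q.2
      = ∑ p : OddSet n × PMatch n, (if p.1.1.card = t ∧ cc p.1 p.2 = c then
          ((if x ∈ p.1.1 then (1 : ℝ) else 0) - (if y ∈ p.1.1 then (1 : ℝ) else 0)) * g p.2 else 0) := by
        rw [Qset, sum_filter]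
    _ = ∑ M : PMatch n, ∑ U : OddSet n, (if U.1.card = t ∧ cc U M = c then
          ((if x ∈ U.1 then (1 : ℝ) else 0) - (if y ∈ U.1 then (1 : ℝ) else 0)) * g M else 0) := by
        rw [← univ_product_univ, sum_product_right]
    _ = ∑ M : PMatch n, g M * ∑ U ∈ univ.filter (fun U : OddSet n => U.1.card = t ∧ cc U M = c),
          ((if x ∈ U.1 then (1 : ℝ) else 0) - (if y ∈ U.1 then (1 : ℝ) else 0)) := by
        refine sum_congr rfl fun M _ => ?_
        rw [sum_filter, mul_sum]
        refine sum_congr rfl fun U _ => ?_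
        split_ifs <;> ring
    _ = 0 := by
        refine sum_eq_zero fun M _ => ?_
        rw [sum_level_dipole_eq_zero, mul_zero]

end Summit.PneNP.PneNP.Theorems.ChebyshevTracialDesignVertexTransitive

end
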